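import Summits.PneNP.PneNP.Theorems.KrwChromaticSteeringStrongCompositionDefs

/-!
# Seat-2 g3 sketch — the ALIGNING-ANNOUNCEMENT LEMMA (pin world)

Crux `StrongComposition` (stmt-PneNP-18538), route KrwChromaticSteering.  Objects for the g3 analysis
note `ANALYSIS-g3-pinworld.md` (seat 2): pin designs, `p`-aligned label pairs, promise-solving, and the
lemma `C(KW_{A×B}) ≤ k + k' + max_p C(KW_{A×B} | Al_p)` — proved here (no sorry): Alice announces
`σ_t := κ(a,t) ⊕ a_{r(a,t)}`, Bob `τ_{t'} := κ'(b,t') ⊕ ¬ b_{r'(b,t')}`; the resulting pattern aligns the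
pair on every shared pinned differing cell, so the promise protocol for that pattern finishes the game.
-/

namespace Summit.PneNP.PneNP.Cruxes.StrongComposition.PinAlignment

open Literature.Computability.Complexity
open Summit.PneNP.PneNP.Theorems.KrwStrongComposition

universe u

section Ask

variable {ι : Type u}

/-- Alice announces the `k` bits `s 0 a, …, s (k-1) a` in order; play then continues in `cont σ`
where `σ` is the announced string. [folklore] -/
def askAlice : (k : ℕ) → (Fin k → ((ι → Bool) → Bool)) → ((Fin k → Bool) → KWTree ι) → KWTree ι
  | 0, _, cont => cont Fin.elim0
  | k + 1, s, cont =>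
      KWTree.alice (s 0) (askAlice k (Fin.tail s) fun σ => cont (Fin.cons false σ))
        (askAlice k (Fin.tail s) fun σ => cont (Fin.cons true σ))

/-- Bob announces the `k` bits `s 0 b, …, s (k-1) b` in order; play then continues in `cont τ`.
[folklore] -/
def askBob : (k : ℕ) → (Fin k → ((ι → Bool) → Bool)) → ((Fin k → Bool) → KWTree ι) → KWTree ι
  | 0, _, cont => cont Fin.elim0
  | k + 1, s, cont =>
      KWTree.bob (s 0) (askBob k (Fin.tail s) fun τ => cont (Fin.cons false τ))
        (askBob k (Fin.tail s) fun τ => cont (Fin.cons true τ))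

theorem run_askAlice : ∀ (k : ℕ) (s : Fin k → ((ι → Bool) → Bool)) (cont : (Fin k → Bool) → KWTree ι)
    (a b : ι → Bool), (askAlice k s cont).run a b = (cont fun t => s t a).run a b
  | 0, s, cont, a, b => by
    simp only [askAlice]
    congr 2
    funext t; exact t.elim0
  | k + 1, s, cont, a, b => by
    simp only [askAlice, KWTree.run_alice]
    have key : ∀ c : Bool, s 0 a = c →
        (askAlice k (Fin.tail s) fun σ => cont (Fin.cons c σ)).run a b = (cont fun t => s t a).run a b := by
      intro c hc
      rw [run_askAlice k]
      have : (Fin.cons c fun t => Fin.tail s t a : Fin (k + 1) → Bool) = fun t => s t a := by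
        rw [← hc]
        exact Fin.cons_self_tail (fun t => s t a)
      rw [this]
    cases h : s 0 a
    · simpa using key false h
    · simpa using key true h

theorem run_askBob : ∀ (k : ℕ) (s : Fin k → ((ι → Bool) → Bool)) (cont : (Fin k → Bool) → KWTree ι)
    (a b : ι → Bool), (askBob k s cont).run a b = (cont fun t => s t b).run a b
  | 0, s, cont, a, b => by
    simp only [askBob]
    congr 2
    funext t; exact t.elim0
  | k + 1, s, cont, a, b => by
    simp only [askBob, KWTree.run_bob]
    have key : ∀ c : Bool, s 0 b = c →
        (askBob k (Fin.tail s) fun τ => cont (Fin.cons c τ)).run a b = (cont fun t => s t b).run a b := by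
      intro c hc
      rw [run_askBob k]
      have : (Fin.cons c fun t => Fin.tail s t b : Fin (k + 1) → Bool) = fun t => s t b := by
        rw [← hc]
        exact Fin.cons_self_tail (fun t => s t b)
      rw [this]
    cases h : s 0 b
    · simpa using key false h
    · simpa using key true h

theorem depth_askAlice_le : ∀ (k : ℕ) (s : Fin k → ((ι → Bool) → Bool))
    (cont : (Fin k → Bool) → KWTree ι) (d : ℕ), (∀ σ, (cont σ).depth ≤ d) →
    (askAlice k s cont).depth ≤ k + d
  | 0, s, cont, d, h => by simpa [askAlice] using h _
  | k + 1, s, cont, d, h => by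
    simp only [askAlice, KWTree.depth_alice]
    have h0 := depth_askAlice_le k (Fin.tail s) (fun σ => cont (Fin.cons false σ)) d fun σ => h _
    have h1 := depth_askAlice_le k (Fin.tail s) (fun σ => cont (Fin.cons true σ)) d fun σ => h _
    omega

theorem depth_askBob_le : ∀ (k : ℕ) (s : Fin k → ((ι → Bool) → Bool))
    (cont : (Fin k → Bool) → KWTree ι) (d : ℕ), (∀ τ, (cont τ).depth ≤ d) →
    (askBob k s cont).depth ≤ k + d
  | 0, s, cont, d, h => by simpa [askBob] using h _
  | k + 1, s, cont, d, h => by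
    simp only [askBob, KWTree.depth_bob]
    have h0 := depth_askBob_le k (Fin.tail s) (fun τ => cont (Fin.cons false τ)) d fun τ => h _
    have h1 := depth_askBob_le k (Fin.tail s) (fun τ => cont (Fin.cons true τ)) d fun τ => h _
    omega

end Ask

section Pins

variable {m n k k' : ℕ}

/-- A PIN DESIGN with `k` pins per label: for the label `a`, pin number `t` sits at the cell
`(row a t, col a t)` and carries the value offset `off a t` (the pinned value is `off ⊕ σ_t` once the
walker / the inputs fix the sign bit `σ_t`).  Rows, columns and offsets may all depend on the label. -/
structure PinDesign (m n k : ℕ) where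
  row : (Fin m → Bool) → Fin k → Fin m
  col : (Fin m → Bool) → Fin k → Fin n
  off : (Fin m → Bool) → Fin k → Bool

/-- `Aligned dA dB σ τ a b`: under the sign pattern `p = (σ, τ)` the label pair `(a, b)` is
`p`-ALIGNED — on every cell pinned by both players that lies in a row where the labels differ, the two
pinned values `off_A ⊕ σ_t` and `off_B ⊕ τ_{t'}` agree (so the pins give no free answer there and the
row's `KW_g` witness must live inside the common pinned sub-cube). -/
def Aligned (dA : PinDesign m n k) (dB : PinDesign m n k') (σ : Fin k → Bool) (τ : Fin k' → Bool)
    (a b : Fin m → Bool) : Prop :=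
  ∀ (t : Fin k) (t' : Fin k'), dA.row a t = dB.row b t' → dA.col a t = dB.col b t' →
    a (dA.row a t) ≠ b (dA.row a t) → xor (dA.off a t) (σ t) = xor (dB.off b t') (τ t')

/-- `SolvesRel T R`: the tree solves the KW game on the PROMISE relation `R` (outputs a differing
coordinate on every pair satisfying `R`). [cite: KarchmerWigderson1990, §2 (relations)] -/
def SolvesRel (T : KWTree (Fin m)) (R : (Fin m → Bool) → (Fin m → Bool) → Prop) : Prop :=
  ∀ a b, R a b → a (T.run a b) ≠ b (T.run a b)

/-- Alice's aligning signature `σ_t := off(a,t) ⊕ a_{row(a,t)}`. -/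
def sigA (dA : PinDesign m n k) (a : Fin m → Bool) : Fin k → Bool :=
  fun t => xor (dA.off a t) (a (dA.row a t))

/-- Bob's aligning signature `τ_{t'} := off'(b,t') ⊕ ¬ b_{row'(b,t')}`. -/
def sigB (dB : PinDesign m n k') (b : Fin m → Bool) : Fin k' → Bool :=
  fun t' => xor (dB.off b t') (!(b (dB.row b t')))

/-- The aligning signatures align every pair: on a shared pinned cell in a differing row both pinned
values equal `a_row` (`= ¬ b_row`). -/
theorem aligned_sig (dA : PinDesign m n k) (dB : PinDesign m n k') (a b : Fin m → Bool) :
    Aligned dA dB (sigA dA a) (sigB dB b) a b := by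
  intro t t' hr _hc hne
  have hb : b (dB.row b t') = b (dA.row a t) := by rw [hr]
  simp only [sigA, sigB, hb]
  revert hne
  cases dA.off a t <;> cases dB.off b t' <;> cases a (dA.row a t) <;> cases b (dA.row a t) <;> decide

/-- Alice's CANCELLING signature `σ_t := off(a,t)`: every pinned value becomes `0`. -/
def cancelA (dA : PinDesign m n k) (a : Fin m → Bool) : Fin k → Bool := fun t => dA.off a t

/-- Bob's cancelling signature `τ_{t'} := off'(b,t')`. -/
def cancelB (dB : PinDesign m n k') (b : Fin m → Bool) : Fin k' → Bool := fun t' => dB.off b t'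

/-- The cancelling signatures also align every pair (all pinned values are `0`); this is the rule the
pin-world walker copies from its target label pair. -/
theorem aligned_cancel (dA : PinDesign m n k) (dB : PinDesign m n k') (a b : Fin m → Bool) :
    Aligned dA dB (cancelA dA a) (cancelB dB b) a b := by
  intro t t' _ _ _
  simp [cancelA, cancelB]

/-- **Aligning-announcement lemma.**  If for every sign pattern `p = (σ, τ)` the KW game of the
rectangle `A × B` restricted to the `p`-aligned pairs has a protocol of depth `≤ d`, then the full game
`KW_{A×B}` has a protocol of depth `≤ k + k' + d`: Alice announces `sigA` (k bits), Bob `sigB` (k' bits),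
the announced pattern aligns the pair (`aligned_sig`), and the promise protocol for it finishes.
Contrapositive (the form the walker uses): `∃ p, C(KW_{A×B} | Al_p) ≥ C(KW_{A×B}) − k − k'` — a
type-segregating adversary can never make EVERY alignment class easy. -/
theorem solvesOn_of_aligned (A B : Set (Fin m → Bool)) (dA : PinDesign m n k) (dB : PinDesign m n k')
    (d : ℕ)
    (h : ∀ (σ : Fin k → Bool) (τ : Fin k' → Bool), ∃ T : KWTree (Fin m),
      SolvesRel T (fun a b => a ∈ A ∧ b ∈ B ∧ Aligned dA dB σ τ a b) ∧ T.depth ≤ d) :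
    ∃ Q : KWTree (Fin m), SolvesOn Q A B ∧ Q.depth ≤ k + k' + d := by
  classical
  choose T hT using h
  refine ⟨askAlice k (fun t a => sigA dA a t) fun σ => askBob k' (fun t' b => sigB dB b t') fun τ => T σ τ,
    ?_, ?_⟩
  · intro a ha b hb
    rw [run_askAlice, run_askBob]
    exact (hT (sigA dA a) (sigB dB b)).1 a b ⟨ha, hb, aligned_sig dA dB a b⟩
  · have := depth_askAlice_le k (fun t a => sigA dA a t)
      (fun σ => askBob k' (fun t' b => sigB dB b t') fun τ => T σ τ) (k' + d)
      (fun σ => depth_askBob_le k' (fun t' b => sigB dB b t') (fun τ => T σ τ) d fun τ => (hT σ τ).2)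
    omega

/-- **Corollary (no wall higher than the pin budget).**  If every protocol for `KW_{A×B}` has depth
`> k + k' + d`, then for SOME sign pattern every protocol for the aligned promise game has depth `> d`:
`max_p C(KW_{A×B} | Al_p) ≥ C(KW_{A×B}) − k − k'`. -/
theorem exists_hard_pattern (A B : Set (Fin m → Bool)) (dA : PinDesign m n k) (dB : PinDesign m n k')
    (d : ℕ) (hC : ∀ Q : KWTree (Fin m), SolvesOn Q A B → k + k' + d < Q.depth) :
    ∃ (σ : Fin k → Bool) (τ : Fin k' → Bool), ∀ T : KWTree (Fin m),
      SolvesRel T (fun a b => a ∈ A ∧ b ∈ B ∧ Aligned dA dB σ τ a b) → d < T.depth := by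
  by_contra hne
  push_neg at hne
  obtain ⟨Q, hQ, hd⟩ := solvesOn_of_aligned A B dA dB d fun σ τ => by
    obtain ⟨T, hT, hTd⟩ := hne σ τ
    exact ⟨T, hT, hTd⟩
  exact absurd (hC Q hQ) (by omega)

end Pins

end Summit.PneNP.PneNP.Cruxes.StrongComposition.PinAlignment
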